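import Literature.Analysis.FluidPDE.SawtoothCascadeK2Classical
import Literature.Analysis.FluidPDE.SawtoothCascadeSmooth

/-!
# K2″ in CLASSICAL typing holds with the energy-method constant `e^{(1−σ⋆)γ}`
(route `AnomalousDissipation/SawtoothPulseCascade`, crux `K2LinearisedCascadeGrowth`,
stmt-AnomalousDissipation-20025 — first rung of the classical restate)

The crux K2″ asserts the per-phase Kelvin–Helmholtz cap `3 e^{σ⋆γ}` (`σ⋆ = sawSigmaStar = 0.30982`)
for the velocity `L²` norm of every linearised response to a residual-comb injection; its CLASSICAL
receptacle is `Literature.Analysis.FluidPDE.SawtoothCascade.K2PhaseGrowthClassical P C` (landed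
`SawtoothCascadeK2Classical.lean`): classical solutions `(w, q)` of
`∂ₜw + (ū·∇)w + (w·∇)ū = νΔw − ∇q`, `div w = 0`, along the cascade carrier `ū = P.field` on the
window `[tInject j₀ hz, tStart (J+1)]`, conclusion
`‖w(t)‖²_{L²} ≤ (C e^{σ⋆γ})^{2(J+1−j₀)} ‖w₀‖²_{L²}` on phase `J`.

This file PROVES the receptacle for every parameter point with `γ ≥ 0`, `δ₀ > 0`, `d > 0`, for EVERY
viscosity `ν ≥ 0` (so any threshold `ν₀`, here `ν₀ = 1`), with the constant of the plain energy method,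
`C = e^{(1−σ⋆)γ}` (i.e. `C e^{σ⋆γ} = e^{γ}`: growth factor at most `e^{γ/2}` in `L²` norm per half pulse,
`e^{γ}` per phase), and on the WHOLE window, not only on phase `J`:

* `vectorL2Sq_le_exp_of_mem_H` / `_V`: on an H (resp. V) half-slot contained in the solution's window,
  `‖w(t)‖² ≤ e^{γ} ‖w(slot start)‖²` — the tree's classical half-pulse bounds
  `CascadeParams.linearised_energy_le_of_mem_H/_V` (energy identity + Grönwall with the production bound
  `2|⟪(w·∇)ū, w⟫| ≤ rate · ‖w‖²`, total strain `γ` per half pulse), after restricting the classical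
  solution from its window to the slot (joint smoothness restricts; the one-sided time derivative within
  a non-degenerate sub-interval agrees with the one within the window);
* `vectorL2Sq_le_exp_sq_of_mem_phase`: `‖w(t)‖² ≤ e^{2γ} ‖w(tStart j)‖²` across phase `j`;
* `vectorL2Sq_le_pow_of_window`, `vectorL2Sq_le_exp_pow`: induction over the phases `j₀, …, J`:
  `‖w(t)‖² ≤ (e^{γ})^{2(J+1−j₀)} ‖w(tInject j₀ hz)‖²` for all `t` in the window;
* `k2PhaseGrowthClassical_exp`: `K2PhaseGrowthClassical P (e^{(1−σ⋆)γ})`;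
* `k2PhaseGrowthClassical_exp_box`: the route's box form,
  `∀ γ ∈ [4,8], ∀ ρN ∈ {2,…,7}, K2PhaseGrowthClassical ⟨γ, 1/4, 2, 1, ρN⟩ (e^{(1−σ⋆)γ})`.

Numbers, not adjectives: the proved constant is `e^{0.69018 γ} ∈ [15.8, 250.0]` on `γ ∈ [4, 8]` against the
crux's `C = 3`; per phase the proved `L²` factor is `e^{γ} ∈ [54.6, 2981]` against the claimed
`3 e^{σ⋆γ} ∈ [10.4, 35.8]`.  So this is the BC5-type first rung of the restated crux (the statement with
the energy-method constant is a theorem, all binders exercised, no vacuity), not the crux: the gap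
`e^{(1−σ⋆)γ} → 3` is exactly the Kelvin–Helmholtz spectral content (`sawSigmaStar`, Orr prefactor) that
K2″ claims.
-/

-- `Summit.<Summit>.<Problem>` is the tree's mandated summit-side namespace (CONVENTIONS §2); for this
-- single-conjunct summit the two coincide, so the duplicate is deliberate (lakefile: off for `Summits`).
set_option linter.dupNamespace false

noncomputable section

namespace Summit.AnomalousDissipation.AnomalousDissipation.Theorems.SawtoothPulseCascade.K2Classical

open Set MeasureTheory
open Literature.Analysis Literature.Analysis.FunctionSpaces Literature.Analysis.FluidPDE
open Literature.Analysis.FluidPDE.SawtoothCascade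
open Literature.Analysis.FluidPDE.SawtoothCascade.CascadeParams

/-- The one-sided time derivative within a non-degenerate sub-interval `[a', b'] ⊆ [a, b]` of a field
jointly smooth on `[a, b]` agrees with the one within `[a, b]` (Mathlib `HasDerivWithinAt.mono` and
`HasDerivWithinAt.derivWithin` on the `uniqueDiffOn_Icc` set; the `𝕋²`-valued case of the tree's
`BDSV.timeDerivWithin_Icc_of_subset`). -/
private theorem timeDerivWithin_Icc_eq_of_subset {a b a' b' : ℝ} (hlt : a' < b')
    (hsub : Icc a' b' ⊆ Icc a b) {w : ℝ → UnitAddTorus (Fin 2) → EuclideanSpace ℝ (Fin 2)}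
    (hw : Torus.IsSmoothSpaceTimeOn (Icc a b) w) {t : ℝ} (ht : t ∈ Icc a' b')
    (x : UnitAddTorus (Fin 2)) :
    Torus.timeDerivWithin (Icc a' b') w t x = Torus.timeDerivWithin (Icc a b) w t x :=
  ((hw.hasDerivWithinAt_slice (hsub ht) x).mono hsub).derivWithin (uniqueDiffOn_Icc hlt t ht)

/-- The squared `L²` norm of a slice is non-negative. -/
private theorem vectorL2Sq_nonneg' (v : UnitAddTorus (Fin 2) → EuclideanSpace ℝ (Fin 2)) :
    0 ≤ Torus.vectorL2Sq v := by
  unfold Torus.vectorL2Sq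
  exact integral_nonneg fun _ => by positivity

/-- **H half-slot inside the window.** Let `γ ≥ 0`, `δ₀ > 0`, `d > 0`, `ν ≥ 0`, and let `(w, q)` be a
classical solution of the Navier–Stokes equations linearised at the cascade carrier,
`∂ₜw + (ū·∇)w + (w·∇)ū = νΔw − ∇q`, `div w = 0`, jointly smooth on a window `[a, b]` containing the H
half-slot `[tStart j, tStart j + tHalf j]`.  Then `‖w(t)‖²_{L²} ≤ e^{γ} ‖w(tStart j)‖²_{L²}` on that slot:
the tree's `CascadeParams.linearised_energy_le_of_mem_H` applied to the restriction of the solution to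
the slot (the cascade field is jointly smooth on `[0,1) ⊇` slot by `cascadeFieldSmooth`, `δ j > 0` by
`δ_pos`). -/
theorem vectorL2Sq_le_exp_of_mem_H (P : CascadeParams) (hγ : 0 ≤ P.γ) (hδ₀ : 0 < P.δ₀) (hd : 0 < P.d)
    {ν : ℝ} (hν : 0 ≤ ν) {a b : ℝ} {w : ℝ → UnitAddTorus (Fin 2) → EuclideanSpace ℝ (Fin 2)}
    {q : ℝ → UnitAddTorus (Fin 2) → ℝ} (hw : Torus.IsSmoothSpaceTimeOn (Icc a b) w)
    (hq : Torus.IsSmoothSpaceTimeOn (Icc a b) q) (hdiv : ∀ t ∈ Icc a b, Torus.IsDivFree (w t))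
    (hlin : ∀ t ∈ Icc a b, ∀ x, Torus.timeDerivWithin (Icc a b) w t x +
      Torus.convect (P.field t) (w t) x + Torus.convect (w t) (P.field t) x =
        ν • Torus.laplacian (w t) x - Torus.gradient (q t) x)
    {j : ℕ} (hsub : Icc (tStart j) (tStart j + tHalf j) ⊆ Icc a b)
    {t : ℝ} (ht : t ∈ Icc (tStart j) (tStart j + tHalf j)) :
    Torus.vectorL2Sq (w t) ≤ Real.exp P.γ * Torus.vectorL2Sq (w (tStart j)) := by
  have hlt : tStart j < tStart j + tHalf j := by linarith [tHalf_pos j]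
  have hF : Torus.IsSmoothSpaceTimeOn (Ico 0 1) P.field := cascadeFieldSmooth P hδ₀ hd
  have hfield : Torus.IsSmoothSpaceTimeOn (Icc (tStart j) (tStart j + tHalf j)) P.field :=
    hF.mono fun s hs => ⟨(tStart_nonneg j).trans hs.1, lt_of_le_of_lt hs.2 (tStart_add_tHalf_lt_one j)⟩
  have hlin' : ∀ s ∈ Icc (tStart j) (tStart j + tHalf j), ∀ x,
      Torus.timeDerivWithin (Icc (tStart j) (tStart j + tHalf j)) w s x +
        Torus.convect (P.field s) (w s) x + Torus.convect (w s) (P.field s) x =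
          ν • Torus.laplacian (w s) x - Torus.gradient (q s) x := by
    intro s hs x
    rw [timeDerivWithin_Icc_eq_of_subset hlt hsub hw hs x]
    exact hlin s (hsub hs) x
  exact (P.linearised_energy_le_of_mem_H hγ (P.δ_pos hδ₀ hd j) hν hfield (hw.mono hsub) (hq.mono hsub)
    (fun s hs => hdiv s (hsub hs)) hlin' ht).2

/-- **V half-slot inside the window**: as `vectorL2Sq_le_exp_of_mem_H` on
`[tStart j + tHalf j, tStart (j+1)]`, from the tree's `CascadeParams.linearised_energy_le_of_mem_V`:
`‖w(t)‖²_{L²} ≤ e^{γ} ‖w(tStart j + tHalf j)‖²_{L²}`. -/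
theorem vectorL2Sq_le_exp_of_mem_V (P : CascadeParams) (hγ : 0 ≤ P.γ) (hδ₀ : 0 < P.δ₀) (hd : 0 < P.d)
    {ν : ℝ} (hν : 0 ≤ ν) {a b : ℝ} {w : ℝ → UnitAddTorus (Fin 2) → EuclideanSpace ℝ (Fin 2)}
    {q : ℝ → UnitAddTorus (Fin 2) → ℝ} (hw : Torus.IsSmoothSpaceTimeOn (Icc a b) w)
    (hq : Torus.IsSmoothSpaceTimeOn (Icc a b) q) (hdiv : ∀ t ∈ Icc a b, Torus.IsDivFree (w t))
    (hlin : ∀ t ∈ Icc a b, ∀ x, Torus.timeDerivWithin (Icc a b) w t x +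
      Torus.convect (P.field t) (w t) x + Torus.convect (w t) (P.field t) x =
        ν • Torus.laplacian (w t) x - Torus.gradient (q t) x)
    {j : ℕ} (hsub : Icc (tStart j + tHalf j) (tStart (j + 1)) ⊆ Icc a b)
    {t : ℝ} (ht : t ∈ Icc (tStart j + tHalf j) (tStart (j + 1))) :
    Torus.vectorL2Sq (w t) ≤ Real.exp P.γ * Torus.vectorL2Sq (w (tStart j + tHalf j)) := by
  have hlt : tStart j + tHalf j < tStart (j + 1) := by rw [tStart_succ]; linarith [tHalf_pos j]
  have hF : Torus.IsSmoothSpaceTimeOn (Ico 0 1) P.field := cascadeFieldSmooth P hδ₀ hd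
  have hfield : Torus.IsSmoothSpaceTimeOn (Icc (tStart j + tHalf j) (tStart (j + 1))) P.field :=
    hF.mono fun s hs =>
      ⟨by linarith [tStart_nonneg j, tHalf_pos j, hs.1], lt_of_le_of_lt hs.2 (tStart_lt_one (j + 1))⟩
  have hlin' : ∀ s ∈ Icc (tStart j + tHalf j) (tStart (j + 1)), ∀ x,
      Torus.timeDerivWithin (Icc (tStart j + tHalf j) (tStart (j + 1))) w s x +
        Torus.convect (P.field s) (w s) x + Torus.convect (w s) (P.field s) x =
          ν • Torus.laplacian (w s) x - Torus.gradient (q s) x := by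
    intro s hs x
    rw [timeDerivWithin_Icc_eq_of_subset hlt hsub hw hs x]
    exact hlin s (hsub hs) x
  exact (P.linearised_energy_le_of_mem_V hγ (P.δ_pos hδ₀ hd j) hν hfield (hw.mono hsub) (hq.mono hsub)
    (fun s hs => hdiv s (hsub hs)) hlin' ht).2

/-- **One phase inside the window**: `‖w(t)‖²_{L²} ≤ e^{2γ} ‖w(tStart j)‖²_{L²}` for
`t ∈ [tStart j, tStart (j+1)]` (H half then V half, `e^{γ}` each; `e^{γ} ≥ 1`). -/
theorem vectorL2Sq_le_exp_sq_of_mem_phase (P : CascadeParams) (hγ : 0 ≤ P.γ) (hδ₀ : 0 < P.δ₀)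
    (hd : 0 < P.d) {ν : ℝ} (hν : 0 ≤ ν) {a b : ℝ}
    {w : ℝ → UnitAddTorus (Fin 2) → EuclideanSpace ℝ (Fin 2)} {q : ℝ → UnitAddTorus (Fin 2) → ℝ}
    (hw : Torus.IsSmoothSpaceTimeOn (Icc a b) w) (hq : Torus.IsSmoothSpaceTimeOn (Icc a b) q)
    (hdiv : ∀ t ∈ Icc a b, Torus.IsDivFree (w t))
    (hlin : ∀ t ∈ Icc a b, ∀ x, Torus.timeDerivWithin (Icc a b) w t x +
      Torus.convect (P.field t) (w t) x + Torus.convect (w t) (P.field t) x =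
        ν • Torus.laplacian (w t) x - Torus.gradient (q t) x)
    {j : ℕ} (hsub : Icc (tStart j) (tStart (j + 1)) ⊆ Icc a b)
    {t : ℝ} (ht : t ∈ Icc (tStart j) (tStart (j + 1))) :
    Torus.vectorL2Sq (w t) ≤ Real.exp P.γ ^ 2 * Torus.vectorL2Sq (w (tStart j)) := by
  have hsucc : tStart (j + 1) = tStart j + 2 * tHalf j := tStart_succ j
  have hH : Icc (tStart j) (tStart j + tHalf j) ⊆ Icc a b := fun s hs =>
    hsub ⟨hs.1, by rw [hsucc]; linarith [hs.2, tHalf_pos j]⟩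
  have hV : Icc (tStart j + tHalf j) (tStart (j + 1)) ⊆ Icc a b := fun s hs =>
    hsub ⟨by linarith [hs.1, tHalf_pos j], hs.2⟩
  have h1 : 1 ≤ Real.exp P.γ := Real.one_le_exp hγ
  have hE0 := vectorL2Sq_nonneg' (w (tStart j))
  rcases le_total t (tStart j + tHalf j) with h | h
  · calc Torus.vectorL2Sq (w t) ≤ Real.exp P.γ * Torus.vectorL2Sq (w (tStart j)) :=
          vectorL2Sq_le_exp_of_mem_H P hγ hδ₀ hd hν hw hq hdiv hlin hH ⟨ht.1, h⟩
      _ ≤ Real.exp P.γ ^ 2 * Torus.vectorL2Sq (w (tStart j)) := by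
          refine mul_le_mul_of_nonneg_right ?_ hE0
          nlinarith
  · have hmid : tStart j + tHalf j ∈ Icc (tStart j) (tStart j + tHalf j) :=
      ⟨by linarith [tHalf_pos j], le_rfl⟩
    calc Torus.vectorL2Sq (w t) ≤ Real.exp P.γ * Torus.vectorL2Sq (w (tStart j + tHalf j)) :=
          vectorL2Sq_le_exp_of_mem_V P hγ hδ₀ hd hν hw hq hdiv hlin hV ⟨h, ht.2⟩
      _ ≤ Real.exp P.γ * (Real.exp P.γ * Torus.vectorL2Sq (w (tStart j))) :=
          mul_le_mul_of_nonneg_left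
            (vectorL2Sq_le_exp_of_mem_H P hγ hδ₀ hd hν hw hq hdiv hlin hH hmid) (Real.exp_pos _).le
      _ = Real.exp P.γ ^ 2 * Torus.vectorL2Sq (w (tStart j)) := by ring

/-- The injection time of phase `j₀` is at most the start of phase `j₀ + 1`. -/
private theorem tInject_le_tStart_succ (j₀ : ℕ) (hz : Bool) :
    CascadeParams.tInject j₀ hz ≤ tStart (j₀ + 1) := by
  unfold CascadeParams.tInject
  rw [tStart_succ]
  cases hz
  · simp only [Bool.false_eq_true, ↓reduceIte]
    linarith [tHalf_pos j₀]
  · simp only [↓reduceIte]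
    linarith [tHalf_pos j₀]

/-- **Induction over the phases.** For a classical linearised solution on a window
`[tInject j₀ hz, b]` and every `n` with `tStart (j₀+n+1) ≤ b`:
`‖w(t)‖²_{L²} ≤ (e^{2γ})^{n+1} ‖w(tInject j₀ hz)‖²_{L²}` for all `t ∈ [tInject j₀ hz, tStart (j₀+n+1)]`
(phases `j₀, …, j₀+n`; the first one is entered at its H start or at its V start according to `hz`). -/
theorem vectorL2Sq_le_pow_of_window (P : CascadeParams) (hγ : 0 ≤ P.γ) (hδ₀ : 0 < P.δ₀) (hd : 0 < P.d)
    {ν : ℝ} (hν : 0 ≤ ν) {j₀ : ℕ} {hz : Bool} {b : ℝ}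
    {w : ℝ → UnitAddTorus (Fin 2) → EuclideanSpace ℝ (Fin 2)} {q : ℝ → UnitAddTorus (Fin 2) → ℝ}
    (hw : Torus.IsSmoothSpaceTimeOn (Icc (CascadeParams.tInject j₀ hz) b) w)
    (hq : Torus.IsSmoothSpaceTimeOn (Icc (CascadeParams.tInject j₀ hz) b) q)
    (hdiv : ∀ t ∈ Icc (CascadeParams.tInject j₀ hz) b, Torus.IsDivFree (w t))
    (hlin : ∀ t ∈ Icc (CascadeParams.tInject j₀ hz) b, ∀ x,
      Torus.timeDerivWithin (Icc (CascadeParams.tInject j₀ hz) b) w t x +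
        Torus.convect (P.field t) (w t) x + Torus.convect (w t) (P.field t) x =
          ν • Torus.laplacian (w t) x - Torus.gradient (q t) x) :
    ∀ n : ℕ, tStart (j₀ + n + 1) ≤ b → ∀ t ∈ Icc (CascadeParams.tInject j₀ hz) (tStart (j₀ + n + 1)),
      Torus.vectorL2Sq (w t) ≤
        (Real.exp P.γ ^ 2) ^ (n + 1) * Torus.vectorL2Sq (w (CascadeParams.tInject j₀ hz)) := by
  have h1 : 1 ≤ Real.exp P.γ ^ 2 := one_le_pow₀ (Real.one_le_exp hγ)
  have ha1 := tInject_le_tStart_succ j₀ hz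
  intro n
  induction n with
  | zero =>
    intro hb t ht
    simp only [Nat.add_zero, zero_add, pow_one] at hb ht ⊢
    cases hz with
    | true =>
      have ha : CascadeParams.tInject j₀ true = tStart j₀ := by
        simp only [CascadeParams.tInject, ↓reduceIte]
      rw [ha] at hw hq hdiv hlin ht ⊢
      exact vectorL2Sq_le_exp_sq_of_mem_phase P hγ hδ₀ hd hν hw hq hdiv hlin
        (fun s hs => ⟨hs.1, hs.2.trans hb⟩) ht
    | false =>
      have ha : CascadeParams.tInject j₀ false = tStart j₀ + tHalf j₀ := by
        simp only [CascadeParams.tInject, Bool.false_eq_true, ↓reduceIte]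
      rw [ha] at hw hq hdiv hlin ht ⊢
      calc Torus.vectorL2Sq (w t) ≤ Real.exp P.γ * Torus.vectorL2Sq (w (tStart j₀ + tHalf j₀)) :=
            vectorL2Sq_le_exp_of_mem_V P hγ hδ₀ hd hν hw hq hdiv hlin
              (fun s hs => ⟨hs.1, hs.2.trans hb⟩) ht
        _ ≤ Real.exp P.γ ^ 2 * Torus.vectorL2Sq (w (tStart j₀ + tHalf j₀)) := by
            refine mul_le_mul_of_nonneg_right ?_ (vectorL2Sq_nonneg' _)
            nlinarith [Real.one_le_exp hγ]
  | succ n ih =>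
    intro hb t ht
    have hidx : j₀ + (n + 1) + 1 = j₀ + n + 1 + 1 := by omega
    rw [hidx] at hb ht
    have hmono : tStart (j₀ + n + 1) ≤ tStart (j₀ + n + 1 + 1) :=
      tStart_strictMono.monotone (Nat.le_succ _)
    have hb' : tStart (j₀ + n + 1) ≤ b := hmono.trans hb
    have ha2 : CascadeParams.tInject j₀ hz ≤ tStart (j₀ + n + 1) :=
      ha1.trans (tStart_strictMono.monotone (by omega))
    rcases le_total t (tStart (j₀ + n + 1)) with h | h
    · calc Torus.vectorL2Sq (w t)
            ≤ (Real.exp P.γ ^ 2) ^ (n + 1) * Torus.vectorL2Sq (w (CascadeParams.tInject j₀ hz)) :=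
            ih hb' t ⟨ht.1, h⟩
        _ ≤ (Real.exp P.γ ^ 2) ^ (n + 1 + 1) * Torus.vectorL2Sq (w (CascadeParams.tInject j₀ hz)) :=
            mul_le_mul_of_nonneg_right (pow_le_pow_right₀ h1 (Nat.le_succ _)) (vectorL2Sq_nonneg' _)
    · have hsub : Icc (tStart (j₀ + n + 1)) (tStart (j₀ + n + 1 + 1)) ⊆
          Icc (CascadeParams.tInject j₀ hz) b := fun s hs => ⟨ha2.trans hs.1, hs.2.trans hb⟩
      calc Torus.vectorL2Sq (w t) ≤ Real.exp P.γ ^ 2 * Torus.vectorL2Sq (w (tStart (j₀ + n + 1))) :=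
            vectorL2Sq_le_exp_sq_of_mem_phase P hγ hδ₀ hd hν hw hq hdiv hlin hsub ⟨h, ht.2⟩
        _ ≤ Real.exp P.γ ^ 2 *
              ((Real.exp P.γ ^ 2) ^ (n + 1) * Torus.vectorL2Sq (w (CascadeParams.tInject j₀ hz))) :=
            mul_le_mul_of_nonneg_left (ih hb' (tStart (j₀ + n + 1)) ⟨ha2, le_rfl⟩) (by positivity)
        _ = (Real.exp P.γ ^ 2) ^ (n + 1 + 1) * Torus.vectorL2Sq (w (CascadeParams.tInject j₀ hz)) := by
            ring

/-- **Energy-method growth bound on the whole K2″ window.** For `γ ≥ 0`, `δ₀ > 0`, `d > 0`, `ν ≥ 0`,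
`j₀ ≤ J`, and every classical solution `(w, q)` of the linearised Navier–Stokes equations along the
cascade carrier on `[tInject j₀ hz, tStart (J+1)]`:
`‖w(t)‖²_{L²} ≤ (e^{γ})^{2(J+1−j₀)} ‖w(tInject j₀ hz)‖²_{L²}` for every `t` in the window. -/
theorem vectorL2Sq_le_exp_pow (P : CascadeParams) (hγ : 0 ≤ P.γ) (hδ₀ : 0 < P.δ₀) (hd : 0 < P.d)
    {ν : ℝ} (hν : 0 ≤ ν) {j₀ J : ℕ} (hj : j₀ ≤ J) (hz : Bool)
    {w : ℝ → UnitAddTorus (Fin 2) → EuclideanSpace ℝ (Fin 2)} {q : ℝ → UnitAddTorus (Fin 2) → ℝ}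
    (hw : Torus.IsSmoothSpaceTimeOn (Icc (CascadeParams.tInject j₀ hz) (tStart (J + 1))) w)
    (hq : Torus.IsSmoothSpaceTimeOn (Icc (CascadeParams.tInject j₀ hz) (tStart (J + 1))) q)
    (hdiv : ∀ t ∈ Icc (CascadeParams.tInject j₀ hz) (tStart (J + 1)), Torus.IsDivFree (w t))
    (hlin : ∀ t ∈ Icc (CascadeParams.tInject j₀ hz) (tStart (J + 1)), ∀ x,
      Torus.timeDerivWithin (Icc (CascadeParams.tInject j₀ hz) (tStart (J + 1))) w t x +
        Torus.convect (P.field t) (w t) x + Torus.convect (w t) (P.field t) x =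
          ν • Torus.laplacian (w t) x - Torus.gradient (q t) x)
    {t : ℝ} (ht : t ∈ Icc (CascadeParams.tInject j₀ hz) (tStart (J + 1))) :
    Torus.vectorL2Sq (w t) ≤
      Real.exp P.γ ^ (2 * (J + 1 - j₀)) * Torus.vectorL2Sq (w (CascadeParams.tInject j₀ hz)) := by
  obtain ⟨n, rfl⟩ : ∃ n, J = j₀ + n := ⟨J - j₀, by omega⟩
  have h := vectorL2Sq_le_pow_of_window P hγ hδ₀ hd hν hw hq hdiv hlin n le_rfl t ht
  have hidx : 2 * (j₀ + n + 1 - j₀) = 2 * (n + 1) := by omega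
  rwa [hidx, pow_mul]

/-- **K2″ in classical typing with the energy-method constant.** For every parameter point with
`γ ≥ 0`, `δ₀ > 0`, `d > 0`: `K2PhaseGrowthClassical P (e^{(1−σ⋆)γ})` — threshold `ν₀ = 1` (any `ν ≥ 0`
works), every injection phase `j₀ ≤ J`, both half-slot types, every residual-comb datum (the datum class
is not used: the bound holds for every classical solution), constant `C = e^{(1−σ⋆)γ}` so that
`C e^{σ⋆γ} = e^{γ}`. -/
theorem k2PhaseGrowthClassical_exp (P : CascadeParams) (hγ : 0 ≤ P.γ) (hδ₀ : 0 < P.δ₀)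
    (hd : 0 < P.d) : K2PhaseGrowthClassical P (Real.exp ((1 - sawSigmaStar) * P.γ)) := by
  refine ⟨1, one_pos, fun ν hν j₀ J hj hz w₀ w q _ hw hq hdiv hlin h0 t ht => ?_⟩
  have hC : Real.exp ((1 - sawSigmaStar) * P.γ) * Real.exp (sawSigmaStar * P.γ) = Real.exp P.γ := by
    rw [← Real.exp_add]
    ring_nf
  rw [hC, ← h0]
  exact vectorL2Sq_le_exp_pow P hγ hδ₀ hd hν.1.le hj hz hw hq hdiv hlin
    ⟨(le_max_left _ _).trans ht.1, ht.2⟩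

/-- **The route's box form of the rung**: for every `γ ∈ [4, 8]` and `ρN ∈ {2, …, 7}` (`δ₀ = 1/4`,
`d = 2`, `N₀ = 1`), `K2PhaseGrowthClassical ⟨γ, 1/4, 2, 1, ρN⟩ (e^{(1−σ⋆)γ})` — the classical K2″
receptacle with the constant `e^{0.69018 γ} ∈ [15.8, 250.0]` in place of the crux's `3`. -/
theorem k2PhaseGrowthClassical_exp_box :
    ∀ γ ∈ Icc (4 : ℝ) 8, ∀ ρN ∈ Finset.Icc 2 7,
      K2PhaseGrowthClassical ⟨γ, 1 / 4, 2, 1, ρN⟩ (Real.exp ((1 - sawSigmaStar) * γ)) := by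
  intro γ hγ ρN _
  exact k2PhaseGrowthClassical_exp ⟨γ, 1 / 4, 2, 1, ρN⟩ (show (0 : ℝ) ≤ γ by linarith [hγ.1])
    (show (0 : ℝ) < 1 / 4 by norm_num) (show (0 : ℝ) < 2 by norm_num)

end Summit.AnomalousDissipation.AnomalousDissipation.Theorems.SawtoothPulseCascade.K2Classical

end
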